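import Mathlib
import HarnessLib
import Summits.ValiantsHypothesis.ValiantsHypothesis.Theorems.SymmetryDialAffineOrbits
import Summits.ValiantsHypothesis.ValiantsHypothesis.Theorems.SymmetryDialTranslationOrbits
import Summits.ValiantsHypothesis.ValiantsHypothesis.Theorems.SymmetryDialDisalignedCFI
import Summits.ValiantsHypothesis.ValiantsHypothesis.Theorems.SymmetryDialDisalignedCFIDisplacement

/-!
# SymmetryDial — disaligned compact CFI: fibrewise shears, the retwist identity, affine shears preserve `inc`/`aff`

Route `SymmetryDial`, workshop `decomp-valiant`, lens 1, gen 9 (NODE-g9 Addendum A, «affine-shear lemma» (S1)–(S3));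
instrument/structure side of item 23711 (LADDER-Valiant rung 0; nothing here bears on VP ≠ VNP).

For a design `D` (`SymmetryDialDisalignedCFI`, p763472) and a fibrewise translation `σ : 𝔽₂^{d₀} → 𝔽₂^r`, the SHEAR
`shear σ : (v, a) ↦ (v, a + σ v)` is a permutation of `𝔽₂^{d₀+r}` (an involution).

* `cfiMat_shear` (RETWIST IDENTITY, (S2)): `cfiMat D S t (shear σ x, shear σ y) = cfiMat D S (t + ∂σ) (x, y)` with the
  coboundary `cobd D σ v w = λ_{v,i}(σ v) + λ_{w,i}(σ w)` on the edge `w = v + gen i` (injective generators).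
* `per01_retwist`: hence `per01 (cfiMat D S (t + ∂σ)) = per01 (cfiMat D S t)` — the `0/1`-permanent of a compact CFI
  matrix depends on the twist only through its class modulo coboundaries (by `per01_reindex`).
* `pair_dualShear_shear_add` ((S1), `inc`): for an AFFINE `σ v = L v + c` (`L` additive) the dual map
  `ξ = (ξ_b, β) ↦ (ξ_b + Lᵀβ, β)` satisfies `ξ'·(shear x + shear y) = ξ·(x + y)` for ALL points `x, y` — affine shears are
  automorphisms of the `inc` relation of the affine matrix structure `𝔄(M)`; `shear_aff` ((S1), `aff`): they preserve
  `x + y + z = e`.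

These are the algebraic facts behind the affine-shear criterion ASC of NODE-g9 Addendum A (the game-level statement over
`StructCkEquiv` is not attempted here).
-/

set_option linter.dupNamespace false

namespace Summit.ValiantsHypothesis.ValiantsHypothesis.Theorems.SymmetryDialDisalignedCFIShear

open Finset
open SymmetryDialAffinePebble (V pair)
open SymmetryDialAffineOrbits (add_self add_add_cancel)
open SymmetryDialTranslationOrbits (pair_add fin2_add_self)
open SymmetryDialDisalignedCFI (base fib Design cfiMat per01 per01_reindex)
open SymmetryDialDisalignedCFIDisplacement (base_append fib_append base_add fib_add cfiMat_apply pair_add_left)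

variable {d₀ r δ : ℕ}

/-! ## §1 Points as (base, fibre) pairs -/

/-- Reassembly of a point from its base and fibre parts. -/
theorem append_base_fib (x : V (d₀ + r)) : Fin.append (base x) (fib x) = x :=
  Fin.append_castAdd_natAdd

/-- Two points are equal iff their base and fibre parts are. -/
theorem eq_iff_base_fib (x y : V (d₀ + r)) : x = y ↔ base x = base y ∧ fib x = fib y := by
  constructor
  · rintro rfl; exact ⟨rfl, rfl⟩
  · rintro ⟨hb, hf⟩
    rw [← append_base_fib x, ← append_base_fib y, hb, hf]

/-- `Fin.append` is additive. -/
theorem append_add (a a' : V d₀) (b b' : V r) :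
    (Fin.append a b : V (d₀ + r)) + Fin.append a' b' = Fin.append (a + a') (b + b') := by
  rw [eq_iff_base_fib]
  simp only [base_add, fib_add, base_append, fib_append, and_self]

/-- The pairing splits along base and fibre: `(ξ_b, β)·z = ξ_b·(base z) + β·(fib z)`. -/
theorem pair_append (ξb : V d₀) (β : V r) (z : V (d₀ + r)) :
    pair (Fin.append ξb β : V (d₀ + r)) z = pair ξb (base z) + pair β (fib z) := by
  unfold pair
  rw [Fin.sum_univ_add]
  congr 1
  · exact sum_congr rfl fun i _ => by simp [Fin.append_left, base]
  · exact sum_congr rfl fun j _ => by simp [Fin.append_right, fib]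

/-! ## §2 The shear by a fibrewise translation -/

/-- The shear `(v, a) ↦ (v, a + σ v)` as a function. -/
def shearFun (σ : V d₀ → V r) (x : V (d₀ + r)) : V (d₀ + r) :=
  Fin.append (base x) (fib x + σ (base x))

/-- The shear fixes the base part. -/
@[simp] theorem base_shearFun (σ : V d₀ → V r) (x : V (d₀ + r)) : base (shearFun σ x) = base x :=
  base_append _ _

/-- The shear translates the fibre part by `σ (base x)`. -/
@[simp] theorem fib_shearFun (σ : V d₀ → V r) (x : V (d₀ + r)) :
    fib (shearFun σ x) = fib x + σ (base x) :=
  fib_append _ _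

/-- The shear is an involution. -/
theorem shearFun_shearFun (σ : V d₀ → V r) (x : V (d₀ + r)) : shearFun σ (shearFun σ x) = x := by
  rw [eq_iff_base_fib, base_shearFun, base_shearFun, fib_shearFun, fib_shearFun, base_shearFun,
    add_add_cancel]
  exact ⟨rfl, rfl⟩

/-- **The shear** by `σ` as a permutation of `𝔽₂^{d₀+r}`. -/
def shear (σ : V d₀ → V r) : V (d₀ + r) ≃ V (d₀ + r) :=
  ⟨shearFun σ, shearFun σ, shearFun_shearFun σ, shearFun_shearFun σ⟩

/-- Unfolding the permutation `shear`. -/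
@[simp] theorem shear_apply (σ : V d₀ → V r) (x : V (d₀ + r)) : shear σ x = shearFun σ x := rfl

/-! ## §3 The coboundary and the retwist identity -/

/-- The COBOUNDARY of `σ` on the ordered base pair `(v, w)`: the change of the CFI bit of the edge `w = v + gen i`
(zero on non-edges). -/
def cobd (D : Design d₀ r δ) (σ : V d₀ → V r) (v w : V d₀) : Fin 2 :=
  ∑ i : Fin δ, if w = v + D.gen i then pair (D.lam v i) (σ v) + pair (D.lam w i) (σ w) else 0

/-- On the edge `(v, v + gen i)` the coboundary is `λ_{v,i}(σ v) + λ_{v+gᵢ,i}(σ (v+gᵢ))` (injective generators). -/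
theorem cobd_edge (D : Design d₀ r δ) (hinj : Function.Injective D.gen) (σ : V d₀ → V r) (v : V d₀)
    (i : Fin δ) :
    cobd D σ v (v + D.gen i) =
      pair (D.lam v i) (σ v) + pair (D.lam (v + D.gen i) i) (σ (v + D.gen i)) := by
  unfold cobd
  rw [sum_eq_single i]
  · rw [if_pos rfl]
  · intro j _ hj
    rw [if_neg]
    intro h
    exact hj (hinj (add_left_cancel h).symm)
  · intro h; exact absurd (mem_univ i) h

/-- `𝔽₂` bookkeeping for the edge clause. -/
theorem fin2_edge_iff (a b c e t : Fin 2) : a + c + (b + e) = t ↔ a + b = t + (c + e) := by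
  revert a b c e t; decide

/-- **RETWIST IDENTITY (S2).** Shearing both arguments by `σ` turns the twist `t` into `t + ∂σ`. -/
theorem cfiMat_shear (D : Design d₀ r δ) (hinj : Function.Injective D.gen) (S : V d₀ → V r → Bool)
    (t : V d₀ → V d₀ → Fin 2) (σ : V d₀ → V r) (x y : V (d₀ + r)) :
    cfiMat D S t (shear σ x, shear σ y) = cfiMat D S (fun v w => t v w + cobd D σ v w) (x, y) := by
  rw [Bool.eq_iff_iff, cfiMat_apply, cfiMat_apply]
  simp only [shear_apply, base_shearFun, fib_shearFun]
  apply or_congr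
  · constructor
    · rintro ⟨h, hS⟩
      refine ⟨h, ?_⟩
      rw [h] at hS ⊢
      rwa [add_add_add_comm, add_self, add_zero] at hS
    · rintro ⟨h, hS⟩
      refine ⟨h, ?_⟩
      rw [h] at hS ⊢
      rwa [add_add_add_comm, add_self, add_zero]
  · refine exists_congr fun i => and_congr_right fun hy => ?_
    rw [hy, cobd_edge D hinj σ (base x) i, pair_add, pair_add]
    exact fin2_edge_iff _ _ _ _ _

/-- **Retwisting by a coboundary preserves the `0/1`-permanent**: the permanent of a compact CFI matrix depends on the
twist only modulo coboundaries. -/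
theorem per01_retwist (D : Design d₀ r δ) (hinj : Function.Injective D.gen) (S : V d₀ → V r → Bool)
    (t : V d₀ → V d₀ → Fin 2) (σ : V d₀ → V r) :
    per01 (cfiMat D S fun v w => t v w + cobd D σ v w) = per01 (cfiMat D S t) := by
  rw [← per01_reindex (cfiMat D S t) (shear σ)]
  congr 1
  funext ij
  exact (cfiMat_shear D hinj S t σ ij.1 ij.2).symm

/-- The same for a GOOD design (injectivity of the generators is part of `Good`). -/
theorem per01_retwist_of_good (D : Design d₀ r δ) (hD : D.Good) (S : V d₀ → V r → Bool)
    (t : V d₀ → V d₀ → Fin 2) (σ : V d₀ → V r) :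
    per01 (cfiMat D S fun v w => t v w + cobd D σ v w) = per01 (cfiMat D S t) :=
  per01_retwist D hD.2.1 S t σ

/-! ## §4 Affine shears preserve `inc` and `aff` ((S1))

An AFFINE fibrewise translation is `σ v = L v + c` with `L` additive.  Its action on dual vectors
`ξ = (ξ_b, β)` is `ξ ↦ (ξ_b + Lᵀ β, β)` where `(Lᵀ β)_j = β·(L e_j)`. -/

/-- The `j`-th standard basis vector of `𝔽₂^{d₀}`. -/
def stdVec (j : Fin d₀) : V d₀ := Pi.single j 1

/-- Every vector is the sum of its coordinates times the basis vectors. -/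
theorem sum_coord_stdVec (v : V d₀) : ∑ j, (fun k => v j * stdVec j k) = v := by
  funext k
  simp only [Finset.sum_apply, stdVec, Pi.single_apply, mul_ite, mul_one, mul_zero]
  simp

/-- The transpose of an additive map `L : 𝔽₂^{d₀} → 𝔽₂^r` applied to `β`. -/
def transp (L : V d₀ → V r) (β : V r) : V d₀ := fun j => pair β (L (stdVec j))

/-- An additive map on `𝔽₂`-vectors is determined by the basis: `L v = Σ_j v_j • L e_j`. -/
theorem additive_apply (L : V d₀ → V r) (hL : ∀ v w, L (v + w) = L v + L w) (v : V d₀) :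
    L v = ∑ j, (fun k => v j * L (stdVec j) k) := by
  have hL0 : L 0 = 0 := by
    have h := hL 0 0; rw [add_zero] at h
    calc L 0 = L 0 + L 0 + L 0 := by rw [add_self, zero_add]
      _ = 0 := by rw [← h, add_self]
  -- `L` commutes with finite sums
  have hsum : ∀ (s : Finset (Fin d₀)) (f : Fin d₀ → V d₀), L (∑ j ∈ s, f j) = ∑ j ∈ s, L (f j) := by
    intro s f
    induction s using Finset.induction_on with
    | empty => simp [hL0]
    | insert a s ha ih => rw [sum_insert ha, sum_insert ha, hL, ih]
  -- scalar `v j ∈ 𝔽₂`: `L (c • e) = c • L e` for `c ∈ {0,1}`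
  have hsc : ∀ (cst : Fin 2) (u : V d₀), L (fun k => cst * u k) = fun k => cst * L u k := by
    intro cst u
    rcases Fin.exists_fin_two.mp ⟨cst, rfl⟩ with h | h
    · rw [h]; simp only [zero_mul]; exact hL0
    · rw [h]; simp only [one_mul]
  conv_lhs => rw [← sum_coord_stdVec v]
  rw [hsum]
  exact sum_congr rfl fun j _ => hsc (v j) (stdVec j)

/-- `β·(L v) = (Lᵀβ)·v` for additive `L`. -/
theorem pair_transp (L : V d₀ → V r) (hL : ∀ v w, L (v + w) = L v + L w) (β : V r) (v : V d₀) :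
    pair β (L v) = pair (transp L β) v := by
  rw [additive_apply L hL v]
  unfold pair transp
  simp only [Finset.sum_apply, mul_sum]
  rw [sum_comm]
  refine sum_congr rfl fun j _ => ?_
  unfold pair
  rw [sum_mul]
  exact sum_congr rfl fun k _ => by simp only [mul_comm, mul_left_comm]

/-- The dual map of the affine shear with linear part `L`. -/
def dualShear (L : V d₀ → V r) (ξ : V (d₀ + r)) : V (d₀ + r) :=
  Fin.append (base ξ + transp L (fib ξ)) (fib ξ)

/-- **(S1, `inc`)** For an affine `σ = L + c`, the dual shear and the point shear jointly preserve the pairing of a dual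
with a SUM OF TWO points (the `inc` relation `ξ·(x+y) = 0` of `𝔄(M)`), for all duals and all points at once. -/
theorem pair_dualShear_shear_add (L : V d₀ → V r) (hL : ∀ v w, L (v + w) = L v + L w) (c : V r)
    (ξ x y : V (d₀ + r)) :
    pair (dualShear L ξ) (shear (fun v => L v + c) x + shear (fun v => L v + c) y) = pair ξ (x + y) := by
  conv_rhs => rw [← append_base_fib ξ]
  unfold dualShear
  simp only [shear_apply, shearFun, append_add, pair_append, base_append, fib_append, pair_add_left, pair_add,
    ← pair_transp L hL]
  -- everything is in `𝔽₂`; the cross terms occur twice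
  generalize pair (base ξ) (base x) = p₁
  generalize pair (base ξ) (base y) = p₂
  generalize pair (fib ξ) (L (base x)) = q₁
  generalize pair (fib ξ) (L (base y)) = q₂
  generalize pair (fib ξ) (fib x) = s₁
  generalize pair (fib ξ) (fib y) = s₂
  generalize pair (fib ξ) c = u
  revert p₁ p₂ q₁ q₂ s₁ s₂ u
  decide

/-- **(S1, `aff`)** An affine shear preserves the affine-dependence relation `x + y + z = e` of points. -/
theorem shear_aff (L : V d₀ → V r) (hL : ∀ v w, L (v + w) = L v + L w) (c : V r)
    (x y z e : V (d₀ + r)) :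
    shear (fun v => L v + c) x + shear (fun v => L v + c) y + shear (fun v => L v + c) z =
        shear (fun v => L v + c) e ↔ x + y + z = e := by
  simp only [shear_apply, shearFun, append_add]
  rw [eq_iff_base_fib, eq_iff_base_fib (x + y + z) e, base_append, fib_append, base_append, fib_append]
  simp only [base_add, fib_add]
  constructor
  · rintro ⟨hb, hf⟩
    refine ⟨hb, ?_⟩
    rw [← hb, hL, hL] at hf
    have e1 : fib x + (L (base x) + c) + (fib y + (L (base y) + c)) + (fib z + (L (base z) + c)) =
        fib x + fib y + fib z + (L (base x) + L (base y) + L (base z) + c) + (c + c) := by abel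
    rw [e1, add_self, add_zero] at hf
    exact add_right_cancel hf
  · rintro ⟨hb, hf⟩
    refine ⟨hb, ?_⟩
    rw [← hf, ← hb, hL, hL]
    calc fib x + (L (base x) + c) + (fib y + (L (base y) + c)) + (fib z + (L (base z) + c))
        = fib x + fib y + fib z + (L (base x) + L (base y) + L (base z) + c) + (c + c) := by abel
      _ = _ := by rw [add_self, add_zero]

end Summit.ValiantsHypothesis.ValiantsHypothesis.Theorems.SymmetryDialDisalignedCFIShear
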